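import Summits.PneNP.PneNP.Theorems.ConvexRankGatesLinAlgGateBlindFacetKernel

/-!
# Route ConvexRankGates, crux `LinAlgGateBlind` (stmt-PneNP-10681): facet count for linear pencils, II — the shear substitution and one-step closure

Support lemmas for the crux (vocabulary of `Theorems/ConvexRankGatesLinAlgGateBlindDefs.lean`); second file of the
facet count for linear pencils `M_W = ∑_{i ∈ W} Xᵢ Kᵢ` (see `…FacetKernel`). The CLOSURE step: let `u ≠ 0` be a
kernel vector of `M_D` over `F[X]` and suppose that every `Kᵢ`, `i ∈ T`, acts on `u` like an element of the pencil
of `D` over the fraction field, `Kᵢ u = ∑_{j ∈ D} c_{ij} K_j u` (`c_{ij} ∈ L ⊇ F[X]`). Then `det M_{D ∪ T} = 0`.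

* `shear_injective` — for `D`, constants `ℓ_j ∈ L` and an embedding `φ : F[X] ↪ L` into a field, the **shear**
  `θ : F[X] → L[ε]`, `X_j ↦ φ(X_j) - ε ℓ_j` (`j ∈ D`), `X_k ↦ ε φ(X_k)` (`k ∉ D`) is INJECTIVE: grading monomials by
  their degree `w` in the variables outside `D`, the coefficient of `ε^{m₀}` in `θ(P)` (`m₀` the least `w` over the
  support of `P`) is `φ` of the `w = m₀` part of `P`, which is non-zero (`coeff_shear_monomial`);
* `det_pencil_union_eq_zero_of_kernel` — **one-step closure**: with `ℓ_j := ∑_{i ∈ T∖D} c_{ij} φ(X_i)` the shear maps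
  `M_{D ∪ T}` to `N = M_D + ε ∑_{i ∈ T∖D} φ(X_i) (K_i - ∑_j c_{ij} K_j)`, which kills `u`; so `det N = 0` over the
  domain `L[ε]`, i.e. `θ(det M_{D∪T}) = 0`, and `det M_{D ∪ T} = 0` by injectivity.

This is the algebraic heart of the rigidity theorem for linear pencils (a kernel-preserving extension of a singular
pencil stays singular); no transcendence theory is needed here. Sources: [folklore] (generic matrices, Edmonds 1967
§5); the argument is the tree's. No new definitions. [folklore]
-/

-- `Summit.PneNP.PneNP.…` duplicates `PneNP` BY DESIGN (single-problem summit).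
set_option linter.dupNamespace false

namespace Summit.PneNP.PneNP.Theorems

open Finset Matrix MvPolynomial

section Shear

variable {F : Type*} [Field F] {ι : Type*} [DecidableEq ι] {L : Type*} [Field L]

/-- **Coefficients of the shear on a monomial.** Let `w(α)` be the degree of the monomial `X^α` in the variables
outside `D`. Under the shear `X_j ↦ φ(X_j) - ε ℓ_j` (`j ∈ D`), `X_k ↦ ε φ(X_k)` (`k ∉ D`), the image of `c X^α` is
`ε^{w(α)} · H` with `H(0) = φ(c X^α)`; hence for `m ≤ w(α)` its `ε^m`-coefficient is `φ(c X^α)` if `w(α) = m` and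
`0` otherwise. [folklore] -/
theorem coeff_shear_monomial (φ : MvPolynomial ι F →+* L) (D : Finset ι) (ℓ : ι → L) (α : ι →₀ ℕ) (c : F)
    {m : ℕ} (hm : m ≤ α.sum fun k e => if k ∈ D then 0 else e) :
    (MvPolynomial.eval₂Hom (Polynomial.C.comp (φ.comp C))
        (fun k => if k ∈ D then Polynomial.C (φ (X k)) - Polynomial.X * Polynomial.C (ℓ k)
          else Polynomial.X * Polynomial.C (φ (X k))) (monomial α c)).coeff m =
      if (α.sum fun k e => if k ∈ D then 0 else e) = m then φ (monomial α c) else 0 := by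
  -- the shear of a variable is `ε^{[k ∉ D]} · h k` with `h k (0) = φ (X k)`
  set h : ι → Polynomial L := fun k =>
    if k ∈ D then Polynomial.C (φ (X k)) - Polynomial.X * Polynomial.C (ℓ k) else Polynomial.C (φ (X k)) with hh
  have hg : ∀ k, (if k ∈ D then Polynomial.C (φ (X k)) - Polynomial.X * Polynomial.C (ℓ k)
      else Polynomial.X * Polynomial.C (φ (X k))) =
        Polynomial.X ^ (if k ∈ D then 0 else 1) * h k := by
    intro k
    simp only [hh]
    split_ifs
    · rw [pow_zero, one_mul]
    · rw [pow_one]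
  have hh0 : ∀ k, (h k).eval 0 = φ (X k) := by
    intro k
    simp only [hh]
    split_ifs
    · simp
    · simp
  rw [MvPolynomial.coe_eval₂Hom, MvPolynomial.eval₂_monomial]
  simp only [RingHom.coe_comp, Function.comp_apply]
  simp_rw [hg]
  set H : Polynomial L := α.prod fun k e => h k ^ e with hH
  set w : ℕ := α.sum fun k e => if k ∈ D then 0 else e with hw
  have hsum : ∑ i ∈ α.support, (if i ∈ D then 0 else 1) * α i = w := by
    rw [hw, Finsupp.sum]
    refine Finset.sum_congr rfl fun i _ => ?_
    split_ifs <;> simp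
  have hprod : (α.prod fun k e => (Polynomial.X ^ (if k ∈ D then 0 else 1) * h k) ^ e) =
      Polynomial.X ^ w * H := by
    rw [hH, Finsupp.prod, Finsupp.prod, ← hsum, ← Finset.prod_pow_eq_pow_sum, ← Finset.prod_mul_distrib]
    refine Finset.prod_congr rfl fun k _ => ?_
    rw [mul_pow, pow_mul]
  rw [hprod, Polynomial.coeff_C_mul, Polynomial.coeff_X_pow_mul']
  have hH0 : H.coeff 0 = φ (monomial α 1) := by
    rw [Polynomial.coeff_zero_eq_eval_zero, hH, Finsupp.prod, Polynomial.eval_prod]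
    simp only [Polynomial.eval_pow, hh0, ← map_pow, ← map_prod]
    congr 1
    rw [MvPolynomial.monomial_eq, C_1, one_mul, Finsupp.prod]
  by_cases hwm : w = m
  · subst hwm
    rw [if_pos le_rfl, Nat.sub_self, hH0, if_pos rfl, ← map_mul]
    congr 1
    rw [MvPolynomial.C_mul_monomial, mul_one]
  · rw [if_neg (fun h => hwm (le_antisymm h hm)), if_neg hwm, mul_zero]

/-- **The shear is injective.** For an embedding `φ : F[X] ↪ L` into a field, a coordinate set `D` and constants
`ℓ_j ∈ L`, the ring homomorphism `θ : F[X] → L[ε]` with `θ(X_j) = φ(X_j) - ε ℓ_j` for `j ∈ D` and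
`θ(X_k) = ε φ(X_k)` for `k ∉ D` (constants mapped by `φ`) is injective. Proof: let `m₀` be the least degree in the
variables outside `D` of a monomial of `P ≠ 0`; by `coeff_shear_monomial` the `ε^{m₀}`-coefficient of `θ(P)` is
`φ(P₀)`, `P₀ ≠ 0` the part of `P` of that degree. [folklore] -/
theorem shear_injective (φ : MvPolynomial ι F →+* L) (hφ : Function.Injective φ) (D : Finset ι) (ℓ : ι → L) :
    Function.Injective (MvPolynomial.eval₂Hom (Polynomial.C.comp (φ.comp C))
        (fun k => if k ∈ D then Polynomial.C (φ (X k)) - Polynomial.X * Polynomial.C (ℓ k)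
          else Polynomial.X * Polynomial.C (φ (X k)))) := by
  set θ := MvPolynomial.eval₂Hom (Polynomial.C.comp (φ.comp C))
        (fun k => if k ∈ D then Polynomial.C (φ (X k)) - Polynomial.X * Polynomial.C (ℓ k)
          else Polynomial.X * Polynomial.C (φ (X k))) with hθ
  rw [injective_iff_map_eq_zero]
  intro P hP
  by_contra hP0
  set w : (ι →₀ ℕ) → ℕ := fun α => α.sum fun k e => if k ∈ D then 0 else e with hw
  have hne : P.support.Nonempty := MvPolynomial.support_nonempty.2 hP0
  set m₀ := (P.support.image w).min' (hne.image w) with hm₀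
  have hm₀le : ∀ α ∈ P.support, m₀ ≤ w α := fun α hα =>
    Finset.min'_le _ _ (mem_image_of_mem w hα)
  obtain ⟨α₀, hα₀, hα₀w⟩ : ∃ α₀ ∈ P.support, w α₀ = m₀ := by
    have h := Finset.min'_mem (P.support.image w) (hne.image w)
    obtain ⟨α₀, hα₀, h'⟩ := mem_image.1 h
    exact ⟨α₀, hα₀, h'⟩
  -- the `w = m₀` part of `P`
  set P₀ : MvPolynomial ι F := ∑ α ∈ P.support.filter (fun α => w α = m₀), monomial α (coeff α P) with hP₀
  have hP₀ne : P₀ ≠ 0 := by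
    intro h0
    have hc : coeff α₀ P₀ = coeff α₀ P := by
      rw [hP₀, MvPolynomial.coeff_sum, Finset.sum_eq_single α₀]
      · rw [MvPolynomial.coeff_monomial, if_pos rfl]
      · intro β _ hβ
        rw [MvPolynomial.coeff_monomial, if_neg hβ]
      · intro h
        exact absurd (mem_filter.2 ⟨hα₀, hα₀w⟩) h
    rw [h0, MvPolynomial.coeff_zero] at hc
    exact (MvPolynomial.mem_support_iff.1 hα₀) hc.symm
  -- the `ε^{m₀}`-coefficient of `θ P` is `φ P₀`
  have hcoeff : (θ P).coeff m₀ = φ P₀ := by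
    conv_lhs => rw [MvPolynomial.as_sum P]
    rw [map_sum, Polynomial.finsetSum_coeff, hP₀, map_sum, Finset.sum_filter]
    refine Finset.sum_congr rfl fun α hα => ?_
    rw [hθ, coeff_shear_monomial φ D ℓ α (coeff α P) (hm₀le α hα)]
  rw [hP, Polynomial.coeff_zero] at hcoeff
  exact hP₀ne (hφ (by rw [← hcoeff, map_zero]))

end Shear

/-! ### One-step closure -/

section Closure

variable {F : Type*} [Field F] {ι : Type*} [DecidableEq ι] {L : Type*} [Field L] {d : ℕ}

/-- **One-step closure (kernel-preserving extensions of a singular pencil stay singular).** Let `φ : F[X] ↪ L` be an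
embedding into a field, `u ≠ 0` a kernel vector of the pencil `M_D = ∑_{j ∈ D} X_j K_j` over `F[X]`, and suppose
that for every `i ∈ T` there are `c_{ij} ∈ L` with `(K_i - ∑_{j ∈ D} c_{ij} K_j) φ(u) = 0`. Then
`det M_{D ∪ T} = 0`. Proof: with `ℓ_j := ∑_{i ∈ T∖D} c_{ij} φ(X_i)` the shear `θ` of `shear_injective` maps
`M_{D∪T}` to `N = M_D(φ X) + ε ∑_{i ∈ T∖D} φ(X_i) (K_i - ∑_j c_{ij} K_j)`, and `N φ(u) = 0`; as `L[ε]` is a domain,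
`θ(det M_{D∪T}) = det N = 0`, so `det M_{D∪T} = 0`. [folklore] -/
theorem det_pencil_union_eq_zero_of_kernel : ∀ {F : Type*} [Field F] {ι : Type*} [DecidableEq ι]
    {L : Type*} [Field L] {d : ℕ} (φ : MvPolynomial ι F →+* L), Function.Injective φ →
    ∀ (K : ι → Matrix (Fin d) (Fin d) F) (D T : Finset ι) (u : Fin d → MvPolynomial ι F), u ≠ 0 →
    (∑ j ∈ D, (X j : MvPolynomial ι F) • (K j).map (C : F →+* MvPolynomial ι F)) *ᵥ u = 0 →
    (∀ i ∈ T, ∃ c : ι → L,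
      ((K i).map (φ.comp C) - ∑ j ∈ D, c j • (K j).map (φ.comp C)) *ᵥ (fun b => φ (u b)) = 0) →
    (∑ j ∈ D ∪ T, (X j : MvPolynomial ι F) • (K j).map (C : F →+* MvPolynomial ι F)).det = 0 := by
  intro F _ ι _ L _ d φ hφ K D T u hu hker hcrit
  classical
  -- WLOG `T` is disjoint from `D`
  set E : Finset ι := T \ D with hE
  have hDT : D ∪ T = D ∪ E := by rw [hE, Finset.union_sdiff_self_eq_union]
  have hED : Disjoint D E := by rw [hE]; exact Finset.disjoint_sdiff
  choose! c hc using hcrit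
  -- scalar data in `L`
  set y : ι → L := fun k => φ (X k) with hy
  set v : ι → Fin d → L := fun j a => φ (((K j).map (C : F →+* MvPolynomial ι F) *ᵥ u) a) with hv
  have hvφ : ∀ j a, ((K j).map (φ.comp C) *ᵥ fun b => φ (u b)) a = v j a := by
    intro j a
    rw [hv]
    simp only [mulVec, dotProduct, Matrix.map_apply, RingHom.coe_comp, Function.comp_apply, map_sum, map_mul]
  -- (I1) the kernel relation, pushed to `L`
  have hI1 : ∀ a, ∑ j ∈ D, y j * v j a = 0 := by
    intro a
    have h := congr_fun hker a
    rw [Pi.zero_apply] at h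
    have h' : φ (((∑ j ∈ D, (X j : MvPolynomial ι F) • (K j).map (C : F →+* MvPolynomial ι F)) *ᵥ u) a) = 0 := by
      rw [h, map_zero]
    rw [← h']
    simp only [mulVec, dotProduct, Matrix.sum_apply, Matrix.smul_apply, Matrix.map_apply, smul_eq_mul,
      Finset.sum_mul, map_sum, map_mul, hy, hv]
    rw [Finset.sum_comm]
    refine Finset.sum_congr rfl fun j _ => ?_
    rw [Finset.mul_sum]
    refine Finset.sum_congr rfl fun b _ => ?_
    ring
  -- (I2) the criterion, pushed to `L`
  have hI2 : ∀ i ∈ E, ∀ a, v i a = ∑ j ∈ D, c i j * v j a := by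
    intro i hi a
    have hiT : i ∈ T := (mem_sdiff.1 hi).1
    have h := congr_fun (hc i hiT) a
    rw [Pi.zero_apply, sub_mulVec, Pi.sub_apply, sub_eq_zero, hvφ] at h
    rw [h, Matrix.sum_mulVec, Finset.sum_apply]
    refine Finset.sum_congr rfl fun j _ => ?_
    rw [Matrix.smul_mulVec, Pi.smul_apply, smul_eq_mul, hvφ]
  -- the shear and the image of the pencil
  set ℓ : ι → L := fun j => ∑ i ∈ E, c i j * y i with hℓ
  set θ := MvPolynomial.eval₂Hom (Polynomial.C.comp (φ.comp C))
      (fun k => if k ∈ D then Polynomial.C (φ (X k)) - Polynomial.X * Polynomial.C (ℓ k)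
        else Polynomial.X * Polynomial.C (φ (X k))) with hθ
  have hθinj : Function.Injective θ := shear_injective φ hφ D ℓ
  set M := ∑ j ∈ D ∪ E, (X j : MvPolynomial ι F) • (K j).map (C : F →+* MvPolynomial ι F) with hM
  set u' : Fin d → Polynomial L := fun b => Polynomial.C (φ (u b)) with hu'
  have hu' : u' ≠ 0 := by
    intro h0
    apply hu
    funext b
    have hb := congr_fun h0 b
    rw [hu', Pi.zero_apply, Polynomial.C_eq_zero] at hb
    exact hφ (by rw [hb, Pi.zero_apply, map_zero])
  -- `N u' = 0` for `N = θ(M)`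
  have hNu : θ.mapMatrix M *ᵥ u' = 0 := by
    funext a
    rw [Pi.zero_apply]
    have hexp : (θ.mapMatrix M *ᵥ u') a =
        ∑ j ∈ D ∪ E, (if j ∈ D then Polynomial.C (y j) - Polynomial.X * Polynomial.C (ℓ j)
          else Polynomial.X * Polynomial.C (y j)) * Polynomial.C (v j a) := by
      simp only [mulVec, dotProduct, RingHom.mapMatrix_apply, Matrix.map_apply, hM, Matrix.sum_apply,
        Matrix.smul_apply, smul_eq_mul, map_sum, map_mul, hθ, MvPolynomial.eval₂Hom_X',
        MvPolynomial.eval₂Hom_C, RingHom.coe_comp, Function.comp_apply, hv, hy, Finset.sum_mul]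
      rw [Finset.sum_comm]
      refine Finset.sum_congr rfl fun j _ => ?_
      simp only [Finset.mul_sum]
      refine Finset.sum_congr rfl fun b _ => ?_
      ring
    rw [hexp, Finset.sum_union hED]
    have hD : ∑ j ∈ D, (if j ∈ D then Polynomial.C (y j) - Polynomial.X * Polynomial.C (ℓ j)
        else Polynomial.X * Polynomial.C (y j)) * Polynomial.C (v j a) =
        Polynomial.C (∑ j ∈ D, y j * v j a) - Polynomial.X * Polynomial.C (∑ j ∈ D, ℓ j * v j a) := by
      rw [map_sum, map_sum, Finset.mul_sum, ← Finset.sum_sub_distrib]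
      refine Finset.sum_congr rfl fun j hj => ?_
      rw [if_pos hj, map_mul, map_mul]
      ring
    have hE' : ∑ i ∈ E, (if i ∈ D then Polynomial.C (y i) - Polynomial.X * Polynomial.C (ℓ i)
        else Polynomial.X * Polynomial.C (y i)) * Polynomial.C (v i a) =
        Polynomial.X * Polynomial.C (∑ i ∈ E, y i * v i a) := by
      rw [map_sum, Finset.mul_sum]
      refine Finset.sum_congr rfl fun i hi => ?_
      rw [if_neg (Finset.disjoint_left.1 hED.symm hi), map_mul]
      ring
    have hswap : ∑ i ∈ E, y i * v i a = ∑ j ∈ D, ℓ j * v j a := by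
      calc ∑ i ∈ E, y i * v i a = ∑ i ∈ E, ∑ j ∈ D, y i * (c i j * v j a) := by
            refine Finset.sum_congr rfl fun i hi => ?_
            rw [hI2 i hi a, Finset.mul_sum]
        _ = ∑ j ∈ D, ∑ i ∈ E, y i * (c i j * v j a) := Finset.sum_comm
        _ = ∑ j ∈ D, ℓ j * v j a := by
            refine Finset.sum_congr rfl fun j _ => ?_
            rw [hℓ, Finset.sum_mul]
            refine Finset.sum_congr rfl fun i _ => ?_
            ring
    rw [hD, hE', hI1 a, hswap, map_zero, zero_sub, neg_add_cancel]
  -- `det N = 0`, hence `θ (det M) = 0`, hence `det M = 0`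
  have hdetN : (θ.mapMatrix M).det = 0 :=
    Matrix.exists_mulVec_eq_zero_iff.1 ⟨u', hu', hNu⟩
  rw [hDT, ← hM]
  apply hθinj
  rw [RingHom.map_det, hdetN, map_zero]

end Closure

end Summit.PneNP.PneNP.Theorems
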